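import Summits.Ventures.PercRepro.C041CutSplitDefs

/-!
# A cut vertex of a loose zone port problem: paths split (p6, gen 25; C-041.md §9)

A SPLIT of a loose problem `L` at a vertex `u`: two vertex sets `S₁ ∋ u` (the gadget side, containing the root set)
and `S₂ ∋ u` (the far side) covering `V`, meeting exactly in `u`, such that every edge lies inside one side, every
zone lies inside one side, and `u` is not a port vertex (the paper's `u″ ∈ K(O)` without terminal edges, never
deleted).  `SReach S A x y` is a path inside `S` avoiding `A`.  THE PATH-SPLITTING LEMMA `rreach_iff_of_mem_S₁` /
`rreach_iff_of_mem_S₂`: for `A ⊆ PV` a vertex of `S₁` is reached from the root set avoiding `A` iff it is reached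
inside `S₁`; a vertex of `S₂` iff `u` is reached inside `S₁` and the vertex is reached from `u` inside `S₂` — the
last visit of `u` splits the path.  `sreach_congr`: a path inside `S` only tests membership in `A` on `S`.
-/

namespace PercRepro

namespace ZonePort

namespace Loose

variable {V E : Type*}

/-- A split of `L` at the cut vertex `u`. -/
structure Split (L : Loose V E) where
  /-- the gadget side -/
  S₁ : Set V
  /-- the far side -/
  S₂ : Set V
  /-- the cut vertex -/
  u : V
  /-- the cut vertex lies on the gadget side -/
  hu₁ : u ∈ S₁
  /-- the cut vertex lies on the far side -/
  hu₂ : u ∈ S₂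
  /-- the two sides cover the vertices -/
  hcover : ∀ v, v ∈ S₁ ∨ v ∈ S₂
  /-- the two sides meet only in the cut vertex -/
  hmeet : ∀ v, v ∈ S₁ → v ∈ S₂ → v = u
  /-- every edge lies inside one side -/
  hadj : ∀ x y, L.adj x y → (x ∈ S₁ ∧ y ∈ S₁) ∨ (x ∈ S₂ ∧ y ∈ S₂)
  /-- the root set lies on the gadget side -/
  hroot : ∀ v ∈ L.root, v ∈ S₁
  /-- every zone lies inside one side -/
  hzone : ∀ C ∈ L.Z, (∀ v ∈ C, v ∈ S₁) ∨ (∀ v ∈ C, v ∈ S₂)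
  /-- the cut vertex is not a port vertex -/
  hu : u ∉ L.PV

/-- `SReach S A x y`: a path from `x` to `y` inside `S` avoiding `A`. -/
def SReach (L : Loose V E) (S A : Set V) (x y : V) : Prop :=
  x ∉ A ∧ Relation.ReflTransGen (fun a b => L.adj a b ∧ b ∉ A ∧ a ∈ S ∧ b ∈ S) x y

/-- Avoiding paths compose. -/
theorem Reach.trans' {L : Loose V E} {A : Set V} {x y z : V} (h₁ : L.Reach A x y) (h₂ : L.Reach A y z) :
    L.Reach A x z :=
  ⟨h₁.1, h₁.2.trans h₂.2⟩

/-- A path inside `S` only tests membership in `A` on `S`: two deleted sets agreeing on `S` give the same paths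
inside `S` (from a start vertex in `S`). -/
theorem sreach_congr {L : Loose V E} {S A A' : Set V} (hAA' : ∀ v ∈ S, v ∈ A ↔ v ∈ A') {x y : V}
    (hx : x ∈ S) : L.SReach S A x y ↔ L.SReach S A' x y := by
  have key : ∀ (B B' : Set V), (∀ v ∈ S, v ∈ B ↔ v ∈ B') → L.SReach S B x y → L.SReach S B' x y := by
    intro B B' hBB' h
    obtain ⟨hxB, hw⟩ := h
    refine ⟨fun h' => hxB ((hBB' x hx).2 h'), ?_⟩
    induction hw with
    | refl => exact Relation.ReflTransGen.refl
    | tail _ hbc ih =>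
      exact ih.tail ⟨hbc.1, fun h' => hbc.2.1 ((hBB' _ hbc.2.2.2).2 h'), hbc.2.2.1, hbc.2.2.2⟩
  exact ⟨key A A' hAA', key A' A fun v hv => (hAA' v hv).symm⟩

/-- A path inside `S` is a path. -/
theorem reach_of_sreach {L : Loose V E} {S A : Set V} {x y : V} (h : L.SReach S A x y) : L.Reach A x y := by
  obtain ⟨hx, hw⟩ := h
  refine ⟨hx, ?_⟩
  induction hw with
  | refl => exact Relation.ReflTransGen.refl
  | tail _ hbc ih => exact ih.tail ⟨hbc.1, hbc.2.1⟩

/-- Paths inside `S` compose. -/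
theorem SReach.trans {L : Loose V E} {S A : Set V} {x y z : V} (h₁ : L.SReach S A x y) (h₂ : L.SReach S A y z) :
    L.SReach S A x z :=
  ⟨h₁.1, h₁.2.trans h₂.2⟩

/-- The empty path inside `S`. -/
theorem SReach.refl {L : Loose V E} {S A : Set V} {x : V} (hx : x ∉ A) : L.SReach S A x x :=
  ⟨hx, Relation.ReflTransGen.refl⟩

/-- A step inside `S`. -/
theorem SReach.tail {L : Loose V E} {S A : Set V} {x y z : V} (h : L.SReach S A x y) (hyz : L.adj y z) (hz : z ∉ A)
    (hy : y ∈ S) (hz' : z ∈ S) : L.SReach S A x z :=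
  ⟨h.1, h.2.tail ⟨hyz, hz, hy, hz'⟩⟩

namespace Split

variable {L : Loose V E} (sp : L.Split)

/-- The cut vertex is in no deleted set `A ⊆ PV`. -/
theorem u_not_mem {A : Set V} (hA : A ⊆ L.PV) : sp.u ∉ A := fun h => sp.hu (hA h)

/-- A zone vertex of `S₁` lies in a zone inside `S₁`. -/
theorem zone_subset_S₁ {C : Finset V} (hC : C ∈ L.Z) {v : V} (hv : v ∈ C) (hv₁ : v ∈ sp.S₁) :
    ∀ w ∈ C, w ∈ sp.S₁ := by
  rcases sp.hzone C hC with h | h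
  · exact h
  · exfalso
    have := sp.hmeet v hv₁ (h v hv)
    subst this
    exact sp.hu ⟨C, hC, hv⟩

/-- A zone vertex of `S₂` lies in a zone inside `S₂`. -/
theorem zone_subset_S₂ {C : Finset V} (hC : C ∈ L.Z) {v : V} (hv : v ∈ C) (hv₂ : v ∈ sp.S₂) :
    ∀ w ∈ C, w ∈ sp.S₂ := by
  rcases sp.hzone C hC with h | h
  · exfalso
    have := sp.hmeet v (h v hv) hv₂
    subst this
    exact sp.hu ⟨C, hC, hv⟩
  · exact h

/-- **Paths split at the cut vertex**: a path from the root set avoiding `A ⊆ PV` reaches a vertex of `S₁` inside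
`S₁`, and a vertex of `S₂` through `u` — `u` reached inside `S₁`, then the vertex inside `S₂`. -/
theorem split_reach {A : Set V} (hA : A ⊆ L.PV) {r v : V} (hr : r ∈ L.root) (h : L.Reach A r v) :
    (v ∈ sp.S₁ → L.SReach sp.S₁ A r v) ∧
      (v ∈ sp.S₂ → L.SReach sp.S₁ A r sp.u ∧ L.SReach sp.S₂ A sp.u v) := by
  obtain ⟨hrA, hw⟩ := h
  have hr₁ : r ∈ sp.S₁ := sp.hroot r hr
  have huA : sp.u ∉ A := sp.u_not_mem hA
  induction hw with
  | refl =>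
    refine ⟨fun _ => SReach.refl hrA, fun hr₂ => ?_⟩
    have := sp.hmeet r hr₁ hr₂
    subst this
    exact ⟨SReach.refl hrA, SReach.refl hrA⟩
  | @tail b d _ hbd ih =>
    obtain ⟨ih₁, ih₂⟩ := ih
    rcases sp.hadj b d hbd.1 with ⟨hb₁, hd₁⟩ | ⟨hb₂, hd₂⟩
    · have hrd : L.SReach sp.S₁ A r d := (ih₁ hb₁).tail hbd.1 hbd.2 hb₁ hd₁
      refine ⟨fun _ => hrd, fun hd₂ => ?_⟩
      have := sp.hmeet d hd₁ hd₂
      subst this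
      exact ⟨hrd, SReach.refl huA⟩
    · obtain ⟨hru, hub⟩ := ih₂ hb₂
      have hud : L.SReach sp.S₂ A sp.u d := hub.tail hbd.1 hbd.2 hb₂ hd₂
      refine ⟨fun hd₁ => ?_, fun _ => ⟨hru, hud⟩⟩
      have := sp.hmeet d hd₁ hd₂
      subst this
      exact hru

/-- A vertex of `S₁` is reached from the root set iff it is reached inside `S₁`. -/
theorem rreach_iff_of_mem_S₁ {A : Set V} (hA : A ⊆ L.PV) {v : V} (hv : v ∈ sp.S₁) :
    L.RReach A v ↔ ∃ r ∈ L.root, L.SReach sp.S₁ A r v := by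
  constructor
  · rintro ⟨r, hr, h⟩
    exact ⟨r, hr, (sp.split_reach hA hr h).1 hv⟩
  · rintro ⟨r, hr, h⟩
    exact ⟨r, hr, reach_of_sreach h⟩

/-- A vertex of `S₂` is reached from the root set iff `u` is reached inside `S₁` and the vertex is reached from `u`
inside `S₂`. -/
theorem rreach_iff_of_mem_S₂ {A : Set V} (hA : A ⊆ L.PV) {v : V} (hv : v ∈ sp.S₂) :
    L.RReach A v ↔ (∃ r ∈ L.root, L.SReach sp.S₁ A r sp.u) ∧ L.SReach sp.S₂ A sp.u v := by
  constructor
  · rintro ⟨r, hr, h⟩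
    obtain ⟨h₁, h₂⟩ := (sp.split_reach hA hr h).2 hv
    exact ⟨⟨r, hr, h₁⟩, h₂⟩
  · rintro ⟨⟨r, hr, h₁⟩, h₂⟩
    exact ⟨r, hr, (reach_of_sreach h₁).trans' (reach_of_sreach h₂)⟩

end Split

end Loose

end ZonePort

end PercRepro
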